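import Mathlib

/-!
# Collision inequality for pair marginals of permutation sets

Crux `Summit.MatrixMultiplication.MatrixMultiplication.Theses.SnSubsetDichotomy.PolynomialSlack`
(item `stmt-MatrixMultiplication-8306`), level-one programme, lead c6 ("beyond one half"). For
`X, Y ⊆ S_n` the PAIR MARGINAL is `m_{XY}(i,j) = #{(x,y) ∈ X × Y : y j = x i}`. This file proves the
COLLISION INEQUALITY used when two quotient sets are dense (`card_sq_mul_pairMarginal_le`):

  `|T|² · m_{US}(k,i) ≤ n · Σ_j m_{ST}(i,j) · m_{TU}(j,k)`.

Proof. Each pair marginal factors through the fibres `c_j(v) = #{t ∈ T : t j = v}` of `T`: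
`m_{ST}(i,j) = Σ_{s ∈ S} c_j(s i)` and `m_{TU}(j,k) = Σ_{u ∈ U} c_j(u k)`, so
`Σ_j m_{ST}(i,j) m_{TU}(j,k) = Σ_{(u,s) ∈ U × S} Σ_j c_j(s i) c_j(u k)`. Dropping the pairs with
`s i ≠ u k` and writing `v = s i = u k` for the others, each remaining pair contributes
`n · Σ_j c_j(v)² ≥ (Σ_j c_j(v))² = |T|²` (Cauchy–Schwarz over `Fin n`; `Σ_j c_j(v) = |T|` because every
permutation takes the value `v` exactly once), and there are `m_{US}(k,i)` such pairs.
-/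

namespace Summit.MatrixMultiplication.MatrixMultiplication.Theorems.PolynomialSlack

open scoped BigOperators

-- `Summit.<Summit>.<Problem>` is the tree's mandated summit-side namespace (CONVENTIONS §2); for
-- this single-conjunct summit the two coincide, so each declaration silences `dupNamespace`.
set_option linter.dupNamespace false

variable {n : ℕ}

/-- The fibre counts `#{t ∈ T : t j = v}` over `j` sum to `|T|`: every permutation takes the value `v`
at exactly one place. [folklore] -/
theorem sum_card_filter_apply_eq_card (T : Finset (Equiv.Perm (Fin n))) (v : Fin n) :
    ∑ j : Fin n, (T.filter fun t => t j = v).card = T.card := by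
  classical
  rw [Finset.card_eq_sum_card_fiberwise (f := fun t : Equiv.Perm (Fin n) => t⁻¹ v) (s := T)
    (t := Finset.univ) (fun _ _ => Finset.mem_univ _)]
  refine Finset.sum_congr rfl fun j _ => ?_
  congr 1
  ext t
  simp only [Finset.mem_filter, Equiv.Perm.inv_eq_iff_eq]
  constructor
  · rintro ⟨h1, h2⟩; exact ⟨h1, h2.symm⟩
  · rintro ⟨h1, h2⟩; exact ⟨h1, h2.symm⟩

/-- Cauchy–Schwarz on the fibre counts: `|T|² = (Σ_j #{t ∈ T : t j = v})² ≤ n · Σ_j #{t ∈ T : t j = v}²`.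
[folklore] -/
theorem card_sq_le_mul_sum_card_filter_sq (T : Finset (Equiv.Perm (Fin n))) (v : Fin n) :
    T.card ^ 2 ≤ n * ∑ j : Fin n, (T.filter fun t => t j = v).card * (T.filter fun t => t j = v).card := by
  classical
  have h := sq_sum_le_card_mul_sum_sq (s := (Finset.univ : Finset (Fin n)))
    (f := fun j => (T.filter fun t => t j = v).card)
  rw [sum_card_filter_apply_eq_card, Finset.card_univ, Fintype.card_fin] at h
  simpa only [sq, Nat.cast_id] using h

/-- The pair marginal `m_{ST}(i,j)` factors through the fibres of `T`:
`#{(s,t) ∈ S × T : t j = s i} = Σ_{s ∈ S} #{t ∈ T : t j = s i}`. [folklore] -/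
theorem pairMarginal_eq_sum_card_filter_fst (S T : Finset (Equiv.Perm (Fin n))) (i j : Fin n) :
    ((S ×ˢ T).filter fun st => st.2 j = st.1 i).card = ∑ s ∈ S, (T.filter fun t => t j = s i).card := by
  classical
  rw [Finset.card_filter, Finset.sum_product]
  simp_rw [Finset.card_filter]

/-- The pair marginal `m_{TU}(j,k)` factors through the fibres of `T`:
`#{(t,u) ∈ T × U : u k = t j} = Σ_{u ∈ U} #{t ∈ T : t j = u k}`. [folklore] -/
theorem pairMarginal_eq_sum_card_filter_snd (T U : Finset (Equiv.Perm (Fin n))) (j k : Fin n) :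
    ((T ×ˢ U).filter fun tu => tu.2 k = tu.1 j).card = ∑ u ∈ U, (T.filter fun t => t j = u k).card := by
  classical
  rw [Finset.card_filter, Finset.sum_product_right]
  simp_rw [Finset.card_filter]
  refine Finset.sum_congr rfl fun u _ => Finset.sum_congr rfl fun t _ => ?_
  exact if_congr eq_comm rfl rfl

/-- **Collision inequality.** For `S, T, U ⊆ S_n` and `i, k`:
`|T|² · m_{US}(k,i) ≤ n · Σ_j m_{ST}(i,j) · m_{TU}(j,k)`, where
`m_{XY}(i,j) = #{(x,y) ∈ X × Y : y j = x i}` is the pair marginal. (Factor both marginals through the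
fibres `#{t ∈ T : t j = v}`, drop the pairs `(u,s)` with `s i ≠ u k`, and apply Cauchy–Schwarz over
`j ∈ Fin n` to each remaining pair.) [folklore] -/
theorem card_sq_mul_pairMarginal_le {n : ℕ} (S T U : Finset (Equiv.Perm (Fin n))) (i k : Fin n) :
    T.card ^ 2 * ((U ×ˢ S).filter fun us => us.2 i = us.1 k).card ≤
      n * ∑ j : Fin n, ((S ×ˢ T).filter fun st => st.2 j = st.1 i).card *
        ((T ×ˢ U).filter fun tu => tu.2 k = tu.1 j).card := by
  classical
  -- factor each product of pair marginals through the fibres of `T`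
  have hfac : ∀ j : Fin n, ((S ×ˢ T).filter fun st => st.2 j = st.1 i).card *
      ((T ×ˢ U).filter fun tu => tu.2 k = tu.1 j).card =
      ∑ us ∈ U ×ˢ S, (T.filter fun t => t j = us.2 i).card * (T.filter fun t => t j = us.1 k).card := by
    intro j
    rw [pairMarginal_eq_sum_card_filter_fst, pairMarginal_eq_sum_card_filter_snd, Finset.sum_mul_sum,
      Finset.sum_product_right]
  rw [Finset.sum_congr rfl fun j _ => hfac j, Finset.sum_comm]
  calc T.card ^ 2 * ((U ×ˢ S).filter fun us => us.2 i = us.1 k).card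
      = ∑ _us ∈ (U ×ˢ S).filter (fun us => us.2 i = us.1 k), T.card ^ 2 := by
        rw [Finset.sum_const, smul_eq_mul, mul_comm]
    _ ≤ ∑ us ∈ (U ×ˢ S).filter (fun us => us.2 i = us.1 k),
          n * ∑ j : Fin n, (T.filter fun t => t j = us.2 i).card * (T.filter fun t => t j = us.1 k).card := by
        refine Finset.sum_le_sum fun us hus => ?_
        rw [(Finset.mem_filter.1 hus).2]
        exact card_sq_le_mul_sum_card_filter_sq T (us.1 k)
    _ ≤ ∑ us ∈ U ×ˢ S,
          n * ∑ j : Fin n, (T.filter fun t => t j = us.2 i).card * (T.filter fun t => t j = us.1 k).card :=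
        Finset.sum_le_sum_of_subset (Finset.filter_subset _ _)
    _ = n * ∑ us ∈ U ×ˢ S, ∑ j : Fin n,
          (T.filter fun t => t j = us.2 i).card * (T.filter fun t => t j = us.1 k).card := by
        rw [Finset.mul_sum]

end Summit.MatrixMultiplication.MatrixMultiplication.Theorems.PolynomialSlack
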